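import Summits.BirchSwinnertonDyer.BirchSwinnertonDyer.Theorems.ByReductionTypeAtTwoTowerFiltrationGap
import HarnessLib

/-!
# The MODULE-FILTRATION certificate in the EXACT «A-currency»: `O1.TowerGapAtTwo W` from two filtered
# counts of the RELAXED layer group `A_n[2]` at ONE layer — NO local interface, NO local constant
# (route ByReductionTypeAtTwo, items stmt-BirchSwinnertonDyer-19271 `OrdKatoHalfAtTwo` (home) and
# stmt-BirchSwinnertonDyer-19922 `MultUpperHalfAtTwo` (rows); seat bsd-2adic-tower-1 GEN 13, D-0074 (T1))

HONEST FRAMING (cell `bsd-2adic`, run/shared/lean/pub/bsd-2adic/, HUMAN RULINGS D-0036/D-0054/D-0074): THEOREMS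
ONLY; nothing asserted; no definition; no new named fact; closes nothing by itself; nothing is booked; BSD is
not proved by any of this. PARTITION: X5@2 TOWER rows (good-ordinary 19271, multiplicative 19922) × p = 2 —
types-the-object-of (a certificate FORMAT for the items AT a class); closes none.

WHAT. Mult-2's part 2 (`…TowerFiltrationLayer`, `natCard_quotient_towerIdeal_eq_natCard_layerFiltration`) proved,
for every curve with `E(K)[p] = 0`, every `ℤ_p`-extension `κ` with topological generator `γ`, every dual datum
and every `m ≤ pⁿ`, the EXACT identity
`#X/(p, T^m)X = #{z ∈ A_n[p] : (conj_γ − id)^[m] z = 0}`, `A_n = h_n⁻¹(Sel_{p^∞}(E/K_∞)) ⊆ H¹(K_n, E[p^∞])`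
(`selmerInftyPreimage κ n`) — the layer Selmer group with the local conditions RELAXED to the ones INDUCED from
`K_∞` (tower-1 part 2b `…TowerLayerClasses` for the two-layer case). Part 3 (`…TowerFiltrationGap`) then read
the window certificate off the CLASSICAL group `Sel_{2^∞}(E/ℚ_n)[2] ⊆ A_n[2]`, paying Greenberg's local kernels
`∏ C_v^{N_v}` (Lemma 3.5) on the upper count. THIS FILE reads BOTH counts off `A_n[2]` itself:

* **`towerGapAtTwo_of_filtration_classCounts`** — `W/ℚ` with odd torsion order, a layer `n`, a window
  `m + k ≤ 2ⁿ`, certificates `2^a ≤ #{z ∈ A_n[2] : ν^[m] z = 0}` and `#{z ∈ A_n[2] : ν^[m+k] z = 0} ≤ 2^d`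
  (`ν = conj_γ − id`, every cyclotomic `κ`, every topological generator `γ`) and `d < k + a` ⟹ `O1.TowerGapAtTwo W`.
  NO finite set `S`, NO constants `C_v`, NO covers `N_v`, NO `h0`/`hC` — the certificate is EXACT
  (`#X/(2,T^{m+k})X = 2^{dim} ≤ 2^d < 2^k·2^a ≤ 2^k·#X/(2,T^m)X`).
* **`towerGapAtTwo_of_filtration_classCounts_upper`** — the HYBRID: lower count classical
  (`2^a ≤ #{z ∈ Sel_{2^∞}(E/ℚ_n)[2] : ν^[m] z = 0}`, free by `Sel_n ≤ A_n`), upper count in the A-currency.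
* **`towerGapAtTwo_of_exponent_classes`** (GEN 13 append) — the EXPONENT certificate in the A-currency: `ν^[b]` kills `A_n[2]`,
  `b < 2ⁿ` ⟹ gap (the A-twin of mult-2 GEN 11's `towerGapAtTwo_of_exponent_localKernelBounds`, largest-block exponent `t = 0`).
* **`towerGapAtTwo_of_filtration_classes_exact`** — the cardinal form `#{…^[m+k]…} < 2^k · #{…^[m]…}` (window form of
  tower-1's two-layer `KatoHalfPinch.towerGapAtTwo_of_layerClasses_exact`; the two-layer hybrid is GEN 6's
  `TowerClass.towerGapAtTwo_of_layerSelmer_of_layerClasses_counts`, KitC).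

WHY (numbers, not adjectives; census `tower/gen13/ACURRENCY-POTENTIAL-mult-irr.tsv`, note
`tower/NOTE-B1-MULT-GEN13.md`): on the 385 E[2]-irreducible multiplicative-at-2 classes still without a class file
and with a GEN-9 deficit, the deficit of the classical window certificate is `≤ C₂ + Σ₃` (the local bits it charges at
layer 3) on 332 classes and `≤ C₂ + Σ₃ − 1` on 255; on the good-ordinary block, where ENGINE A already evaluates
the induced structure (CERT-TOWER-E1 §1, countersign B1), `dim A_j[2] = dim Sel₂(E/ℚ_j)` on 355 of 445 layer-2
member rows. The induced local condition at a MULTIPLICATIVE place above 2 — the one input the engines lacked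
(CERT-TOWER-E1 ADDENDUM-3 C5) — is read in the note (Greenberg §2 `Im κ_η = Im λ_η` + inflation–restriction:
the `e₀`-component of the class lies in `⟨2 + y_n⟩` (split) resp. `⟨−3, 2 + y_n⟩` (non-split)).

WHAT IS DISPLAYED, NOT PROVED (in class files using these doors): the two counts (ENGINE output, evidence tier —
exactly as the classical `d_j`); nothing else: no PRINT/MEMO binder enters the gap.

References: R. Greenberg, LNM 1716 (1999), §1 p. 60, §2 Prop. 2.4, §3 pp. 85–90 (Lemmas 3.1–3.5);
L. Washington, *Introduction to Cyclotomic Fields*, §13.2; the docstrings of the two files above.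
-/
set_option autoImplicit false
-- the Theorems namespace of this sub repeats the summit name by design (D-0017 nested layout: Summit.<S>.<Sub>)
set_option linter.dupNamespace false

noncomputable section

open scoped Classical

open NumberField IsDedekindDomain WeierstrassCurve Literature.NumberTheory.EllipticCurves
  Literature.NumberTheory.EllipticCurves.IwasawaDual PowerSeries Summit.BirchSwinnertonDyer.Rank1Residual
  Summit.BirchSwinnertonDyer.Rank1Residual.X5.TowerGap Summit.BirchSwinnertonDyer.Rank1Residual.X5.O1

universe u

namespace Summit.BirchSwinnertonDyer.BirchSwinnertonDyer.Theorems.TowerFiltration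
/-! ## §5 `p = 2` over `ℚ`: the GAP certificate in the A-currency (no local error term) -/

section Curve

variable (W : WeierstrassCurve ℚ) [W.IsElliptic]

/-- **The GAP certificate from the `(σ−1)`-filtration of the RELAXED layer group `A_n[2]` — EXACT, no
local interface.** `W/ℚ` with odd torsion order; a layer `n` and a window `m + k ≤ 2ⁿ`; certificates
`2^a ≤ #{z ∈ A_n[2] : (conj_γ − id)^[m] z = 0}` and `#{z ∈ A_n[2] : (conj_γ − id)^[m+k] z = 0} ≤ 2^d` for every
cyclotomic `κ` with topological generator `γ` (`A_n = selmerInftyPreimage κ n = h_n⁻¹(Sel_{2^∞}(E/ℚ_∞))`), and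
`d < k + a`. Then `O1.TowerGapAtTwo W` with the window `(m, k)`:
`#X/(2,T^{m+k})X = #{…^[m+k]…} ≤ 2^d < 2^k·2^a ≤ 2^k·#{…^[m]…} = 2^k·#X/(2,T^m)X`
(`natCard_quotient_towerIdeal_eq_natCard_layerFiltration` twice). [cite: GreenbergLNM1716, §1 p. 60 and §3 pp. 85–86 (Lemmas 3.1, 3.2)]
[cite: Washington1997, §13.2] -/
theorem towerGapAtTwo_of_filtration_classCounts (htors : ¬ 2 ∣ W.torsionOrder) {n m k a d : ℕ}
    (hmk : m + k ≤ 2 ^ n)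
    (hlow : ∀ (κ : ZpExtension ℚ 2) (γ : Field.absoluteGaloisGroup ℚ), κ.IsCyclotomic →
      κ.IsTopGenerator γ →
        2 ^ a ≤ Nat.card {z : W.selmerInftyPreimage κ n // 2 • z = 0 ∧
          (⇑(W.conjH1 2 (κ.layerSubgroup n) γ -
            AddMonoidHom.id (W.subgroupH1 2 (κ.layerSubgroup n))))^[m]
            (z : W.subgroupH1 2 (κ.layerSubgroup n)) = 0})
    (hup : ∀ (κ : ZpExtension ℚ 2) (γ : Field.absoluteGaloisGroup ℚ), κ.IsCyclotomic →
      κ.IsTopGenerator γ →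
        Nat.card {z : W.selmerInftyPreimage κ n // 2 • z = 0 ∧
          (⇑(W.conjH1 2 (κ.layerSubgroup n) γ -
            AddMonoidHom.id (W.subgroupH1 2 (κ.layerSubgroup n))))^[m + k]
            (z : W.subgroupH1 2 (κ.layerSubgroup n)) = 0} ≤ 2 ^ d)
    (had : d < k + a) : TowerGapAtTwo W := by
  intro κ γ hκ hγ _ D
  haveI : Module.Finite (IwasawaAlgebra 2) D.X := D.module_finite_holds hγ
  have hK := Iwasawa.forall_smul_eq_zero_imp_of_not_dvd_torsionOrder W htors
  have hm : m ≤ 2 ^ n := le_trans (Nat.le_add_right m k) hmk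
  refine ⟨m, k, ?_⟩
  calc Nat.card (D.X ⧸ (towerIdeal 2 (m + k) • ⊤ : Submodule (IwasawaAlgebra 2) D.X))
      = Nat.card {z : W.selmerInftyPreimage κ n // 2 • z = 0 ∧
          (⇑(W.conjH1 2 (κ.layerSubgroup n) γ -
            AddMonoidHom.id (W.subgroupH1 2 (κ.layerSubgroup n))))^[m + k]
            (z : W.subgroupH1 2 (κ.layerSubgroup n)) = 0} :=
        natCard_quotient_towerIdeal_eq_natCard_layerFiltration W κ D hγ hK n hmk
    _ ≤ 2 ^ d := hup κ γ hκ hγ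
    _ < 2 ^ (k + a) := Nat.pow_lt_pow_right (by norm_num) had
    _ = 2 ^ k * 2 ^ a := by rw [pow_add]
    _ ≤ 2 ^ k * Nat.card {z : W.selmerInftyPreimage κ n // 2 • z = 0 ∧
          (⇑(W.conjH1 2 (κ.layerSubgroup n) γ -
            AddMonoidHom.id (W.subgroupH1 2 (κ.layerSubgroup n))))^[m]
            (z : W.subgroupH1 2 (κ.layerSubgroup n)) = 0} :=
        Nat.mul_le_mul_left _ (hlow κ γ hκ hγ)
    _ = 2 ^ k * Nat.card (D.X ⧸ (towerIdeal 2 m • ⊤ : Submodule (IwasawaAlgebra 2) D.X)) := by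
        rw [natCard_quotient_towerIdeal_eq_natCard_layerFiltration W κ D hγ hK n hm]

/-- **The HYBRID window certificate: lower count classical, upper count in the A-currency.** `W/ℚ` with odd
torsion order; `m + k ≤ 2ⁿ`; `2^a ≤ #{z ∈ Sel_{2^∞}(E/ℚ_n)[2] : (conj_γ − id)^[m] z = 0}` (the free lower bound:
`Sel_n ≤ A_n`, `natCard_selmerFiltration_le`), `#{z ∈ A_n[2] : (conj_γ − id)^[m+k] z = 0} ≤ 2^d`, `d < k + a`
⟹ `O1.TowerGapAtTwo W`. For engines that evaluate the induced structure only as an upper bound.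
[cite: GreenbergLNM1716, §1 p. 60 and §3 pp. 85–86 (Lemmas 3.1, 3.2)] [cite: Washington1997, §13.2] -/
theorem towerGapAtTwo_of_filtration_classCounts_upper (htors : ¬ 2 ∣ W.torsionOrder) {n m k a d : ℕ}
    (hmk : m + k ≤ 2 ^ n)
    (hlow : ∀ (κ : ZpExtension ℚ 2) (γ : Field.absoluteGaloisGroup ℚ), κ.IsCyclotomic →
      κ.IsTopGenerator γ →
        2 ^ a ≤ Nat.card {z : W.selmerLayer κ n // 2 • z = 0 ∧
          (⇑(W.conjH1 2 (κ.layerSubgroup n) γ -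
            AddMonoidHom.id (W.subgroupH1 2 (κ.layerSubgroup n))))^[m]
            (z : W.subgroupH1 2 (κ.layerSubgroup n)) = 0})
    (hup : ∀ (κ : ZpExtension ℚ 2) (γ : Field.absoluteGaloisGroup ℚ), κ.IsCyclotomic →
      κ.IsTopGenerator γ →
        Nat.card {z : W.selmerInftyPreimage κ n // 2 • z = 0 ∧
          (⇑(W.conjH1 2 (κ.layerSubgroup n) γ -
            AddMonoidHom.id (W.subgroupH1 2 (κ.layerSubgroup n))))^[m + k]
            (z : W.subgroupH1 2 (κ.layerSubgroup n)) = 0} ≤ 2 ^ d)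
    (had : d < k + a) : TowerGapAtTwo W := by
  intro κ γ hκ hγ _ D
  haveI : Module.Finite (IwasawaAlgebra 2) D.X := D.module_finite_holds hγ
  have hK := Iwasawa.forall_smul_eq_zero_imp_of_not_dvd_torsionOrder W htors
  have hm : m ≤ 2 ^ n := le_trans (Nat.le_add_right m k) hmk
  -- the filtered pieces of `A_n[2]` are finite (they inject into the finite `A_n[2]`)
  haveI := TowerLayer.finite_layerClasses W κ D hK n
  have hfinA : Finite {z : W.selmerInftyPreimage κ n // 2 • z = 0 ∧
      (⇑(W.conjH1 2 (κ.layerSubgroup n) γ -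
          AddMonoidHom.id (W.subgroupH1 2 (κ.layerSubgroup n))))^[m]
        (z : W.subgroupH1 2 (κ.layerSubgroup n)) = 0} :=
    Finite.of_injective (fun z ↦ (⟨z.1, z.2.1⟩ : {z : W.selmerInftyPreimage κ n // 2 • z = 0}))
      fun z z' h ↦ Subtype.ext (congrArg (fun w : {z : W.selmerInftyPreimage κ n // 2 • z = 0} ↦ w.1) h)
  refine ⟨m, k, ?_⟩
  calc Nat.card (D.X ⧸ (towerIdeal 2 (m + k) • ⊤ : Submodule (IwasawaAlgebra 2) D.X))
      = Nat.card {z : W.selmerInftyPreimage κ n // 2 • z = 0 ∧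
          (⇑(W.conjH1 2 (κ.layerSubgroup n) γ -
            AddMonoidHom.id (W.subgroupH1 2 (κ.layerSubgroup n))))^[m + k]
            (z : W.subgroupH1 2 (κ.layerSubgroup n)) = 0} :=
        natCard_quotient_towerIdeal_eq_natCard_layerFiltration W κ D hγ hK n hmk
    _ ≤ 2 ^ d := hup κ γ hκ hγ
    _ < 2 ^ (k + a) := Nat.pow_lt_pow_right (by norm_num) had
    _ = 2 ^ k * 2 ^ a := by rw [pow_add]
    _ ≤ 2 ^ k * Nat.card {z : W.selmerLayer κ n // 2 • z = 0 ∧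
          (⇑(W.conjH1 2 (κ.layerSubgroup n) γ -
            AddMonoidHom.id (W.subgroupH1 2 (κ.layerSubgroup n))))^[m]
            (z : W.subgroupH1 2 (κ.layerSubgroup n)) = 0} :=
        Nat.mul_le_mul_left _ (hlow κ γ hκ hγ)
    _ ≤ 2 ^ k * Nat.card {z : W.selmerInftyPreimage κ n // 2 • z = 0 ∧
          (⇑(W.conjH1 2 (κ.layerSubgroup n) γ -
            AddMonoidHom.id (W.subgroupH1 2 (κ.layerSubgroup n))))^[m]
            (z : W.subgroupH1 2 (κ.layerSubgroup n)) = 0} :=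
        Nat.mul_le_mul_left _ (natCard_selmerFiltration_le W κ hfinA)
    _ = 2 ^ k * Nat.card (D.X ⧸ (towerIdeal 2 m • ⊤ : Submodule (IwasawaAlgebra 2) D.X)) := by
        rw [natCard_quotient_towerIdeal_eq_natCard_layerFiltration W κ D hγ hK n hm]

/-- **The GAP certificate, A-currency, EXACT cardinal form**: `2 ∤ #E(ℚ)_tors`, `m + k ≤ 2ⁿ` and
`#{z ∈ A_n[2] : ν^[m+k] z = 0} < 2^k · #{z ∈ A_n[2] : ν^[m] z = 0}` for every cyclotomic `κ` and
topological generator `γ` ⟹ `O1.TowerGapAtTwo W` — both sides ARE `#X/(2,T^{m+k})X` and `2^k · #X/(2,T^m)X`;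
the window form of tower-1's `KatoHalfPinch.towerGapAtTwo_of_layerClasses_exact` (`m = 2^j`, `k = 2^{j'} − 2^j`).
[cite: GreenbergLNM1716, §1 p. 60 and §3 pp. 85–86 (Lemmas 3.1, 3.2)] [cite: Washington1997, §13.2] -/
theorem towerGapAtTwo_of_filtration_classes_exact (htors : ¬ 2 ∣ W.torsionOrder) {n m k : ℕ}
    (hmk : m + k ≤ 2 ^ n)
    (hA : ∀ (κ : ZpExtension ℚ 2) (γ : Field.absoluteGaloisGroup ℚ), κ.IsCyclotomic →
      κ.IsTopGenerator γ →
        Nat.card {z : W.selmerInftyPreimage κ n // 2 • z = 0 ∧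
          (⇑(W.conjH1 2 (κ.layerSubgroup n) γ -
            AddMonoidHom.id (W.subgroupH1 2 (κ.layerSubgroup n))))^[m + k]
            (z : W.subgroupH1 2 (κ.layerSubgroup n)) = 0} <
        2 ^ k * Nat.card {z : W.selmerInftyPreimage κ n // 2 • z = 0 ∧
          (⇑(W.conjH1 2 (κ.layerSubgroup n) γ -
            AddMonoidHom.id (W.subgroupH1 2 (κ.layerSubgroup n))))^[m]
            (z : W.subgroupH1 2 (κ.layerSubgroup n)) = 0}) : TowerGapAtTwo W := by
  intro κ γ hκ hγ _ D
  haveI : Module.Finite (IwasawaAlgebra 2) D.X := D.module_finite_holds hγ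
  have hK := Iwasawa.forall_smul_eq_zero_imp_of_not_dvd_torsionOrder W htors
  have hm : m ≤ 2 ^ n := le_trans (Nat.le_add_right m k) hmk
  refine ⟨m, k, ?_⟩
  rw [natCard_quotient_towerIdeal_eq_natCard_layerFiltration W κ D hγ hK n hmk,
    natCard_quotient_towerIdeal_eq_natCard_layerFiltration W κ D hγ hK n hm]
  exact hA κ γ hκ hγ

/-- **The EXPONENT certificate in the A-currency (no numerals at all).** `W/ℚ` with odd torsion order, a layer `n` and
`b < 2ⁿ`; if `(conj_γ − id)^[b]` KILLS the `2`-torsion of the relaxed layer group `A_n = h_n⁻¹(Sel_{2^∞}(E/ℚ_∞))` for every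
cyclotomic `κ` and topological generator `γ`, then `O1.TowerGapAtTwo W` (window `(b, 1)`: both pieces are all of `A_n[2]`, so
`#X/(2,T^{b+1})X = #X/(2,T^b)X < 2 · #X/(2,T^b)X`). The A-twin of mult-2 GEN 11's exponent door
`towerGapAtTwo_of_exponent_localKernelBounds` (there: `(conj_γ − id)^[b]` kills `Sel_{2^∞}(E/ℚ_n)[2]` and `b + t < 2ⁿ` with `2^t`
the largest local block; here `t = 0`). [cite: GreenbergLNM1716, §1 p. 60 and §3 pp. 85–86 (Lemmas 3.1, 3.2)] [cite: Washington1997, §13.2] -/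
theorem towerGapAtTwo_of_exponent_classes (htors : ¬ 2 ∣ W.torsionOrder) {n b : ℕ} (hb : b < 2 ^ n)
    (hkill : ∀ (κ : ZpExtension ℚ 2) (γ : Field.absoluteGaloisGroup ℚ), κ.IsCyclotomic →
      κ.IsTopGenerator γ → ∀ z : W.selmerInftyPreimage κ n, 2 • z = 0 →
        (⇑(W.conjH1 2 (κ.layerSubgroup n) γ -
          AddMonoidHom.id (W.subgroupH1 2 (κ.layerSubgroup n))))^[b]
          (z : W.subgroupH1 2 (κ.layerSubgroup n)) = 0) : TowerGapAtTwo W := by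
  intro κ γ hκ hγ _ D
  haveI : Module.Finite (IwasawaAlgebra 2) D.X := D.module_finite_holds hγ
  have hK := Iwasawa.forall_smul_eq_zero_imp_of_not_dvd_torsionOrder W htors
  have hb1 : b + 1 ≤ 2 ^ n := hb
  -- the filtered pieces are finite (they inject into the finite `A_n[2]`)
  haveI := TowerLayer.finite_layerClasses W κ D hK n
  have hfinA : ∀ m' : ℕ, Finite {z : W.selmerInftyPreimage κ n // 2 • z = 0 ∧
      (⇑(W.conjH1 2 (κ.layerSubgroup n) γ -
          AddMonoidHom.id (W.subgroupH1 2 (κ.layerSubgroup n))))^[m']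
        (z : W.subgroupH1 2 (κ.layerSubgroup n)) = 0} := fun m' ↦
    Finite.of_injective (fun z ↦ (⟨z.1, z.2.1⟩ : {z : W.selmerInftyPreimage κ n // 2 • z = 0}))
      fun z z' h ↦ Subtype.ext (congrArg (fun w : {z : W.selmerInftyPreimage κ n // 2 • z = 0} ↦ w.1) h)
  haveI := hfinA b
  haveI := hfinA (b + 1)
  -- the piece at `b + 1` injects into the piece at `b` (every `2`-torsion class is already killed by `ν^[b]`)
  have hle : Nat.card {z : W.selmerInftyPreimage κ n // 2 • z = 0 ∧
        (⇑(W.conjH1 2 (κ.layerSubgroup n) γ -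
          AddMonoidHom.id (W.subgroupH1 2 (κ.layerSubgroup n))))^[b + 1]
          (z : W.subgroupH1 2 (κ.layerSubgroup n)) = 0} ≤
      Nat.card {z : W.selmerInftyPreimage κ n // 2 • z = 0 ∧
        (⇑(W.conjH1 2 (κ.layerSubgroup n) γ -
          AddMonoidHom.id (W.subgroupH1 2 (κ.layerSubgroup n))))^[b]
          (z : W.subgroupH1 2 (κ.layerSubgroup n)) = 0} :=
    Nat.card_le_card_of_injective (fun z ↦ ⟨z.1, z.2.1, hkill κ γ hκ hγ z.1 z.2.1⟩)
      fun z z' h ↦ Subtype.ext (congrArg (fun w : {z : W.selmerInftyPreimage κ n // 2 • z = 0 ∧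
        (⇑(W.conjH1 2 (κ.layerSubgroup n) γ -
          AddMonoidHom.id (W.subgroupH1 2 (κ.layerSubgroup n))))^[b]
          (z : W.subgroupH1 2 (κ.layerSubgroup n)) = 0} ↦ w.1) h)
  -- the piece at `b` is non-empty (it contains `0`)
  have hpos : 0 < Nat.card {z : W.selmerInftyPreimage κ n // 2 • z = 0 ∧
        (⇑(W.conjH1 2 (κ.layerSubgroup n) γ -
          AddMonoidHom.id (W.subgroupH1 2 (κ.layerSubgroup n))))^[b]
          (z : W.subgroupH1 2 (κ.layerSubgroup n)) = 0} := by
    haveI : Nonempty {z : W.selmerInftyPreimage κ n // 2 • z = 0 ∧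
        (⇑(W.conjH1 2 (κ.layerSubgroup n) γ -
          AddMonoidHom.id (W.subgroupH1 2 (κ.layerSubgroup n))))^[b]
          (z : W.subgroupH1 2 (κ.layerSubgroup n)) = 0} :=
      ⟨⟨0, smul_zero _, by rw [ZeroMemClass.coe_zero]; exact Function.iterate_fixed (map_zero _) b⟩⟩
    exact Nat.card_pos
  refine ⟨b, 1, ?_⟩
  rw [natCard_quotient_towerIdeal_eq_natCard_layerFiltration W κ D hγ hK n hb1,
    natCard_quotient_towerIdeal_eq_natCard_layerFiltration W κ D hγ hK n hb.le, pow_one]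
  omega

end Curve

end Summit.BirchSwinnertonDyer.BirchSwinnertonDyer.Theorems.TowerFiltration

end
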